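import Summits.ABC.IUTFork.LanaEtaLimThetaFunctions
import HarnessLib

/-!
# L-LANA vacuity audit: the hypotheses of `containment_of_functionData` hold TOGETHER at layer L6's genuine
# `Π^tp_X̲̲` — a worked instance of LANA's Fig. 3 with a constant "theta function" (honest label: DEGENERATE `θ`,
# GENUINE group / cohomology / Kummer maps / integral structure)

Record-only support file (D-0012; seat abc-iut-c312-4 gen 7, L-LANA level, plan/LLANA-SPEC N14; the cell's standing
vacuity audit of fork-level hypothesis structures, LANA Rem. 8.2.1). TAKES NO SIDE on [IUTchIII] Cor. 3.12.
Gen 7's `LanaEtaLimThetaFunctions.containment_of_functionData` derives LANA's CONTAINMENT (§6.2 (g) p. 36: "the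
image of the map (say, `ψ_v`) from (the Frobenius-like version of) the theta monoid `M^Θ_{v,∞}` to the product of
`∞H¹(D_t, (l·Δ_Θ)(Π_v))` is contained in the image of `φ_v`") from FOUR inputs on gen 5's Fig. 3 record
`S : EtaLimSide`: (1) the synchronization `c : Λ(K̄_vˣ) → (l·Δ_Θ)(Π_v)` is bijective; (2) `O^▷` is root-closed;
(3) `KummerImageEq` — §6.2 (d) p. 34: "In the strict formulation, one distinguishes the Frobenioid-theoretic theta
monoid `M^{Θ,Frob}_{v,∞}`, which appears on the left side of Figure 3, from its Kummer-theoretic image, which is the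
object actually described by the cohomological expression above" — the Kummer image of the mono-theta side IS
`M^Θ_{v,∞} = O^×_v(Π_v)·∞θ(Π_v)`; (4) a `FunctionData` presentation of `θ(Π_v)`.
[cite: LANA2026Report, §6.2 (d) p. 34, §6.2 (g) p. 36, Rem 8.2.1 p. 42]

THIS FILE shows the four are JOINTLY SATISFIABLE — with (3) and the conclusions PROVED, not assumed — at layer L6's
GENUINE data `Π := Π^tp_X̲̲`, `Π_{v,Ÿ} := Π^tp_Ÿ̲̲`, `A' := l·Δ_Θ`, `A := ℚ̄_pˣ` (gen 5 `EtaLimSide.ofDoubleUnderline`),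
`O^▷ := {|·| ≤ 1}` (gen 7 `intMonoidUnits`), ANY bijective `c` (constructed ones exist: abc-iut-w4-d007
`exists_cyclotomeCoefficients_of_cyclotomeTower`):
§1 (generic) `EtaLimSide.selfKummer` — the record whose mono-theta side IS the étale-like theta monoid
   `M^Θ_{v,∞} ≤ ∞H¹(Π_{v,Ÿ}, A')` with `Kummer := inclusion`, `Θ-Λ-rgd := id` (LANA's own "schematic shorthand":
   "We use the same notation `M^Θ_{v,∞}` for both sides", p. 34); `selfKummer_kummerImageEq` — (3) HOLDS for it;
   `FunctionData.toSelfKummer`; `selfKummer_containment_of_functionData` / `…_factors_…`.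
§2 (model) `ℚ_p`-rational units are `Π^tp_X̲̲`-fixed (`unitsOfPadic_mem_fixedPoints`: the action is through
   `ε : Π^tp_X̲̲ → G_{ℚ_p}`); `genuineConstants` — the record at the genuine data with `θ :=` the `Π^tp_Ÿ̲̲`-level Kummer
   classes of a family of `Π^tp_Ÿ̲̲`-fixed INTEGRAL constants `a_i` (a constant IS a function: gen 7
   `FunctionData.ofConstants`), mono-theta side self-presented; **`genuineConstants_spec`**: `KummerImageEq ∧
   Containment ∧ Factors ∧ φ_v injective` — ALL FOUR PROVED there (injectivity: abc-iut-w4-d007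
   `h1LimKummer_injective_of_coeff`, `[G_{ℚ_p} : ε(Π^tp_Ÿ̲̲)] < ∞`).
HONEST LABEL: DEGENERATE in `θ` (constants, one label with `D_t := Π^tp_Ÿ̲̲`) — a certificate that the typed inputs
are jointly inhabited over the genuine group, NOT a model of [EtTh]'s theta function or of the [IUTchII] §2
evaluation points (layers L2/L6). [cite: LANA2026Report, §6.2 pp. 33–36] NOT here: any judgement.
-/

noncomputable section

namespace Summit.ABC
namespace IUTFork

open Literature.AnabelianGeometry.EtaleTheta
open Literature.IUT.HodgeArakelov
open Literature.IUT.HodgeArakelov.CohomologySystemOfContH1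

/-! ## 1. Generic: the self-presented mono-theta side -/

namespace EtaLimSide

variable {P : TopGroup.{0}} {G' : Type} [Group G'] [TopologicalSpace G'] [IsTopologicalGroup G']
  {φ : P →* G'} {A' : Subgroup G'} [A'.Normal] [IsMulCommutative A'] {H : Subgroup P}
  {A : Type} [CommGroup A] [MulDistribMulAction P A] [TopologicalSpace A] [RootableBy A ℕ]
  (S : EtaLimSide φ A' H A)

/-- **The self-presented record**: same étale side, labels, Kummer maps and integral structure as `S`, with the
mono-theta side (Step 4) taken to be the étale-like theta monoid `M^Θ_{v,∞} = O^×(Π_v)·⟨∞θ(Π_v)⟩` itself, `Kummer :=`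
its inclusion into `∞H¹(Π_{v,Ÿ}, A')`, `Θ-Λ-rgd := id` — LANA's "schematic shorthand" (p. 34) made literal.
[cite: LANA2026Report, §6.2 (d) p. 34, §6.2 (e) p. 35] -/
def selfKummer : EtaLimSide φ A' H A :=
  { S with
    MFrob := ↥S.toEtaSteps.thetaMonoidEt
    instMFrob := inferInstance
    H1Yext := Multiplicative (h1Lim φ A' H ⊥)
    instH1Yext := inferInstance
    kum := S.toEtaSteps.thetaMonoidEt.subtype
    rgd := MulEquiv.refl _ }

/-- The étale-like theta monoid is unchanged by self-presentation (it only reads `θ`, `O^×`, `c`).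
[cite: LANA2026Report, §6.2 (d) p. 34] -/
theorem selfKummer_thetaMonoidEt : S.selfKummer.toEtaSteps.thetaMonoidEt = S.toEtaSteps.thetaMonoidEt := rfl

/-- **`KummerImageEq` HOLDS for the self-presented record** (the image of an inclusion is the submonoid).
[cite: LANA2026Report, §6.2 (d) p. 34] -/
theorem selfKummer_kummerImageEq : S.selfKummer.toEtaSteps.KummerImageEq := by
  change MonoidHom.mrange ((MulEquiv.refl _).toMonoidHom.comp S.toEtaSteps.thetaMonoidEt.subtype) =
    S.toEtaSteps.thetaMonoidEt
  ext x
  exact ⟨fun ⟨m, hm⟩ => hm ▸ m.2, fun hx => ⟨⟨x, hx⟩, rfl⟩⟩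

variable {S} {M : Type} [CommGroup M] [MulDistribMulAction P M] [TopologicalSpace M]

/-- A presentation of `θ(Π_v)` by functions for `S` is one for `S.selfKummer` (same `θ`, labels, `c`, `O^▷`).
[cite: LANA2026Report, §6.2 (c) p. 34] -/
def FunctionData.toSelfKummer (F : S.FunctionData M) : S.selfKummer.FunctionData M :=
  ⟨F.cM, F.ι, F.fn, F.fixed, F.root, F.isOpen_stabilizer_root, F.thetaClasses_subset, F.ev, F.ev_smul,
    F.c_map_ev, F.ev_fn_mem⟩

/-- **Containment for the self-presented record from a presentation by functions** (`c` bijective, `O^▷`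
root-closed) — input (3) discharged by `selfKummer_kummerImageEq`. [cite: LANA2026Report, §6.2 (g) p. 36] -/
theorem selfKummer_containment_of_functionData (hc : Function.Bijective S.c.hom)
    (hroot : ∀ (a : A) (n : ℕ), 0 < n → a ^ n ∈ S.O → a ∈ S.O) (F : S.FunctionData M) :
    S.selfKummer.toEtaSteps.Containment :=
  containment_of_functionData (S := S.selfKummer) hc hroot S.selfKummer_kummerImageEq F.toSelfKummer

/-- … and the §9.1 (f) factorisation when the `κ_{D_t}` are injective. [cite: LANA2026Report, §9.1 (f) p. 45] -/
theorem selfKummer_factors_of_functionData (hc : Function.Bijective S.c.hom)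
    (hinj : ∀ t, Function.Injective (S.kappaD t))
    (hroot : ∀ (a : A) (n : ℕ), 0 < n → a ^ n ∈ S.O → a ∈ S.O) (F : S.FunctionData M) :
    S.selfKummer.toEtaSteps.Factors :=
  factors_of_functionData (S := S.selfKummer) hc hinj hroot S.selfKummer_kummerImageEq F.toSelfKummer

end EtaLimSide

/-! ## 2. At layer L6's genuine `Π^tp_X̲̲` -/

section Model

open Literature.IUT.HodgeArakelov.EtaleThetaDataOfSetting

variable {p : ℕ} [Fact p.Prime] {D : ThetaSetting p} {E : D.EtaleThetaData} {l : ℕ} (C : E.DoubleUnderline l)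
  [TopologicalSpace (PadicAlgCl p)ˣ] {Γ₀ : Type} [LinearOrderedCommGroupWithZero Γ₀]
  (w : Valuation (PadicAlgCl p) Γ₀)

/-- A `ℚ_p`-rational unit, read in `ℚ̄_pˣ`. [cite: LANA2026Report, §0.4 (b) p. 8] -/
abbrev unitsOfPadic : ℚ_[p]ˣ →* (PadicAlgCl p)ˣ := Units.map (algebraMap ℚ_[p] (PadicAlgCl p)).toMonoidHom

omit [TopologicalSpace (PadicAlgCl p)ˣ] in
/-- **`ℚ_p`-rational units are fixed by every subgroup of `Π^tp_X̲̲`** — the action on `ℚ̄_pˣ` is through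
`ε : Π^tp_X̲̲ → G_{ℚ_p} = Gal(ℚ̄_p/ℚ_p)` (abc-iut-w4-d007 `unitsAction`), which fixes `ℚ_p`.
[cite: LANA2026Report, §3.9 p. 21] -/
theorem unitsOfPadic_mem_fixedPoints (H : Subgroup (Pi C)) (x : ℚ_[p]ˣ) :
    unitsOfPadic x ∈ MulAction.fixedPoints H (PadicAlgCl p)ˣ := fun h =>
  Units.ext ((aug C (h : Pi C)).commutes (x : ℚ_[p]))

variable (c : CyclotomeCoefficients (phi C) (D.lDeltaTheta l) (PadicAlgCl p)ˣ) {ι : Type}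
  (a : ι → (PadicAlgCl p)ˣ) (ha : ∀ i, a i ∈ MulAction.fixedPoints (PiYdd C) (PadicAlgCl p)ˣ)

/-- `θ :=` the `Π^tp_Ÿ̲̲`-level Kummer classes (gen 7 `thetaClassOf` at level `⊤`) of a family of `Π^tp_Ÿ̲̲`-fixed
constants `a_i ∈ ℚ̄_pˣ` — a DEGENERATE stand-in for (6-1). [cite: LANA2026Report, §6.2 (c) p. 34] -/
def thetaOfConstants : Set (Multiplicative (h1Lim (phi C) (D.lDeltaTheta l) (PiYdd C) ⊥)) :=
  Set.range fun i => thetaClassOf (phi C) (D.lDeltaTheta l) (PiYdd C) c (RootSystem.ofRootableBy (a i)) (ha i)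
    fun _ => isOpen_stabilizer_units C _

/-- **The worked instance at the genuine data**: gen 5's `ofDoubleUnderline` (genuine `Π^tp_X̲̲`, `Π^tp_Ÿ̲̲`, `l·Δ_Θ`,
`ℚ̄_pˣ`; one label with `D_t := Π^tp_Ÿ̲̲`) with `θ := thetaOfConstants`, `O^▷ := {|·| ≤ 1}`, `O^× := {|·| = 1}`, theta
value `q`, and the mono-theta side SELF-PRESENTED (§1). [cite: LANA2026Report, §6.2 pp. 33–36] -/
def genuineConstants (q : intMonoidUnits w) :
    EtaLimSide (phi C) (D.lDeltaTheta l) (PiYdd C) (PadicAlgCl p)ˣ :=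
  (EtaLimSide.ofDoubleUnderline C c (thetaOfConstants C c a ha) (intMonoidUnits w) (unitGrp w)
    (unitGrp_le_intMonoidUnits w) q).selfKummer

/-- Its presentation by functions: the constants themselves (gen 7 `FunctionData.ofConstants`), granted they are
integral. [cite: LANA2026Report, §6.2 (c) p. 34] -/
def genuineConstantsFunctionData (q : intMonoidUnits w) (haO : ∀ i, a i ∈ intMonoidUnits w) :
    (genuineConstants C w c a ha q).FunctionData (PadicAlgCl p)ˣ :=
  (EtaLimSide.FunctionData.ofConstants
      (EtaLimSide.ofDoubleUnderline C c (thetaOfConstants C c a ha) (intMonoidUnits w) (unitGrp w)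
        (unitGrp_le_intMonoidUnits w) q)
      a ha haO fun _ hx => hx).toSelfKummer

/-- **ALL FOUR AT ONCE at the genuine group**: for a bijective synchronization `c` and integral constants `a_i`,
the record `genuineConstants` satisfies `KummerImageEq` (PROVED), LANA's Containment (PROVED via gen 7's
`containment_of_functionData`: `c` bijective, `{|·| ≤ 1}` root-closed, the constants presentation), the §9.1 (f)
factorisation, and `φ_v` is injective (abc-iut-w4-d007: `[G_{ℚ_p} : ε(Π^tp_Ÿ̲̲)] < ∞`). Honest label: degenerate
`θ`, genuine everything else. [cite: LANA2026Report, §6.2 (g) p. 36, §9.1 (f) p. 45, Rem 8.2.1 p. 42] -/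
theorem genuineConstants_spec (hc : Function.Bijective c.hom) (q : intMonoidUnits w)
    (haO : ∀ i, a i ∈ intMonoidUnits w) :
    (genuineConstants C w c a ha q).toEtaSteps.KummerImageEq ∧
      (genuineConstants C w c a ha q).toEtaSteps.Containment ∧
      (genuineConstants C w c a ha q).toEtaSteps.Factors ∧
      Function.Injective (genuineConstants C w c a ha q).toEtaSteps.phiProd := by
  have hroot : ∀ (u : (PadicAlgCl p)ˣ) (n : ℕ), 0 < n → u ^ n ∈ intMonoidUnits w → u ∈ intMonoidUnits w :=
    fun _ _ hn h => mem_intMonoidUnits_of_pow_mem w hn h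
  have hinj : ∀ t, Function.Injective ((genuineConstants C w c a ha q).kappaD t) := fun _ =>
    h1LimKummer_injective_of_coeff C (phi C) (D.lDeltaTheta l) c (PiYdd C) hc
  refine ⟨EtaLimSide.selfKummer_kummerImageEq _, ?_, ?_, ?_⟩
  · exact EtaLimSide.selfKummer_containment_of_functionData hc hroot
      (EtaLimSide.FunctionData.ofConstants _ a ha haO fun _ hx => hx)
  · exact EtaLimSide.selfKummer_factors_of_functionData hc hinj hroot
      (EtaLimSide.FunctionData.ofConstants _ a ha haO fun _ hx => hx)
  · exact (genuineConstants C w c a ha q).phiProd_injective_of hinj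

/-- The degenerate `θ` is NONEMPTY as soon as the family is (e.g. one `ℚ_p`-rational integral unit such as `p`).
[cite: LANA2026Report, §6.2 (c) p. 34] -/
theorem thetaOfConstants_nonempty [Nonempty ι] : (thetaOfConstants C c a ha).Nonempty :=
  Set.range_nonempty _

/-- In particular with the single `ℚ_p`-rational constant `p` (integral: `|p| ≤ 1` for the `p`-adic valuation
`w = padicVal`, supplied as the hypothesis `hp` for a general `w`): a record with nonempty `θ` at the genuine data
satisfying all four. [cite: LANA2026Report, §6.2 pp. 33–36, Rem 8.2.1 p. 42] -/
theorem exists_genuine_record_all_four (hc : Function.Bijective c.hom)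
    (hp : unitsOfPadic (Units.mk0 (p : ℚ_[p]) (Nat.cast_ne_zero.mpr (Fact.out : p.Prime).ne_zero)) ∈
      intMonoidUnits w) :
    ∃ S : EtaLimSide (phi C) (D.lDeltaTheta l) (PiYdd C) (PadicAlgCl p)ˣ,
      S.thetaClasses.Nonempty ∧ S.toEtaSteps.KummerImageEq ∧ S.toEtaSteps.Containment ∧
        S.toEtaSteps.Factors ∧ Function.Injective S.toEtaSteps.phiProd := by
  let π : (PadicAlgCl p)ˣ :=
    unitsOfPadic (Units.mk0 (p : ℚ_[p]) (Nat.cast_ne_zero.mpr (Fact.out : p.Prime).ne_zero))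
  have hπ : ∀ _ : PUnit, π ∈ MulAction.fixedPoints (PiYdd C) (PadicAlgCl p)ˣ := fun _ =>
    unitsOfPadic_mem_fixedPoints C (PiYdd C) _
  refine ⟨genuineConstants C w c (fun _ : PUnit => π) hπ ⟨π, hp⟩,
    thetaOfConstants_nonempty C c _ hπ, genuineConstants_spec C w c _ hπ hc ⟨π, hp⟩ fun _ => hp⟩

omit [TopologicalSpace (PadicAlgCl p)ˣ] in
/-- For the `p`-adic valuation itself (`Valued.v` on `ℚ̄_p`, gen 0's `padicVal p`) the constant `p` IS integral:
`|p| = 1/p ≤ 1` (Mathlib `PadicAlgCl.valuation_p`). [cite: LANA2026Report, §0.4 (b) p. 8] -/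
theorem unitsOfPadic_p_mem_intMonoidUnits :
    unitsOfPadic (Units.mk0 (p : ℚ_[p]) (Nat.cast_ne_zero.mpr (Fact.out : p.Prime).ne_zero)) ∈
      intMonoidUnits (Valued.v : Valuation (PadicAlgCl p) NNReal) := by
  rw [mem_intMonoidUnits_iff]
  change Valued.v (algebraMap ℚ_[p] (PadicAlgCl p) (p : ℚ_[p])) ≤ 1
  rw [map_natCast, PadicAlgCl.valuation_p, one_div]
  exact inv_le_one_of_one_le₀ (by exact_mod_cast (Fact.out : p.Prime).one_lt.le)

/-- **Hypothesis-free form for the `p`-adic valuation**: for every bijective synchronization `c` there is a record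
at layer L6's genuine `Π^tp_X̲̲` data with NONEMPTY `θ`, `O^▷ = {|·|_p ≤ 1}`, satisfying `KummerImageEq`, LANA's
Containment, the §9.1 (f) factorisation, with `φ_v` injective — all PROVED (degenerate `θ`: the constant `p`).
[cite: LANA2026Report, §6.2 pp. 33–36, Rem 8.2.1 p. 42] -/
theorem exists_genuine_record_all_four_padic (hc : Function.Bijective c.hom) :
    ∃ S : EtaLimSide (phi C) (D.lDeltaTheta l) (PiYdd C) (PadicAlgCl p)ˣ,
      S.O = intMonoidUnits (Valued.v : Valuation (PadicAlgCl p) NNReal) ∧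
      S.thetaClasses.Nonempty ∧ S.toEtaSteps.KummerImageEq ∧ S.toEtaSteps.Containment ∧
        S.toEtaSteps.Factors ∧ Function.Injective S.toEtaSteps.phiProd := by
  let π : (PadicAlgCl p)ˣ :=
    unitsOfPadic (Units.mk0 (p : ℚ_[p]) (Nat.cast_ne_zero.mpr (Fact.out : p.Prime).ne_zero))
  have hπ : ∀ _ : PUnit, π ∈ MulAction.fixedPoints (PiYdd C) (PadicAlgCl p)ˣ := fun _ =>
    unitsOfPadic_mem_fixedPoints C (PiYdd C) _
  have hp := unitsOfPadic_p_mem_intMonoidUnits (p := p)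
  exact ⟨genuineConstants C Valued.v c (fun _ : PUnit => π) hπ ⟨π, hp⟩, rfl,
    thetaOfConstants_nonempty C c _ hπ, genuineConstants_spec C Valued.v c _ hπ hc ⟨π, hp⟩ fun _ => hp⟩

end Model

end IUTFork

end Summit.ABC

end
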